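import Summits.BirchSwinnertonDyer.BirchSwinnertonDyer.Theorems.AlignedTransportAtTwoMainConjectureOfRankZeroBSDAtTwoFineRoadRealKummerLine
import HarnessLib

/-!
# The Kummer letter IS the letter with the least real abscissa (`T_w = T_{min}`): halves of `T_{min}` are anti-invariant under
# complex conjugation, so `T_{min} ∈ (c_w − 1)·E[2^∞]`; the `T_{min}`-class survives in `E[2^∞]`, the `T_{mid}`- and `T_{max}`-classes do not

Cell `bsd-f1-sign2`, WIDTH-5 attach seat `bsd-line-att-p5` (gen 9) on line `birth` of crux C2 stmt-BirchSwinnertonDyer-22298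
`MainConjectureOfRankZeroBSDAtTwo` (route `AlignedTransportAtTwo`); sequel of `…FineRoadRealKummerLine` (att-p5 g9), which left the Kummer
letter `T_w` pinned only in `ℚ_w`-coordinates (cell bsd-2adic's arch package: «the point above the least root `e₃`»). A `--supports 22298
--as helper` file. HONEST FRAMING: THEOREMS ONLY — no definition, no named fact, no `sorry`; C2-NEUTRAL; BSD is NOT proved by any of this.

WHAT. For any field `K` of characteristic `0`, any elliptic `E/K`, any `τ ∈ ker ρ̄_{E,2}` acting as complex conjugation under
`ι : K̄ → ℂ` and the letter `T_{i₁}` whose abscissa `ι e_{i₁}` is the LEAST of the three (real) ones: every half `Q` of `T_{i₁}` satisfies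
**`τ Q = −Q`** (`smul_eq_neg_of_add_self_eq_T_min`) — the halving identity (tree `four_mul_sq_xco_sub_eq`) gives
`(x(Q) − e_{i₁})² = α_{i₁} > 0`, so `x(Q)` is real and `τ Q = ±Q`; `τ Q = Q` would make `2y + a₁x + a₃` real with square
`4(x − e₀)(x − e₁)(x − e₂) = 4ab(2s − a − b) < 0` (`s = x − e_{i₁}`, `s² = ab`). Hence `τ Q − Q = T_{i₁}`, i.e. **`T_{min}` lies on the line
`(τ − 1)·E[2^∞]`** (`exists_primary_smul_sub_eq_T_min`; contrast att-p5 g8 `RealKummerTranslation`: `T_{mid}` is not `τ P − P` for any `P`).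
Over `ℚ` with `Δ_E > 0` this pins the Kummer letter: **`T_w = T_{min}`** (`kummerLetter_eq_T_min`), so NEITHER `T_{mid}` NOR `T_{max}` lies on
`(c_w − 1)·E[2^∞]` (`not_exists_primary_smul_sub_eq_T_of_ne_min`), and the `E[2]`-class with value `T_{min}` (`RealKummerValues`, units `eᵢ − q`)
is an explicit class OUTSIDE `infKer H E[2] w` whose push-forward lies INSIDE `infKer H E[2^∞] w`
(`exists_not_mem_infKer_and_torsionToPrimaryH1Sub_mem_infKer`; witness of `RealKummerLine.relIndex_infKer_comap_eq_two`).

§1 two real facts; §2 `psi_sq_eq_four_mul_prod` (`(2y + a₁x + a₃)² = 4∏(x − eᵢ)`, Vieta); §3 **`smul_eq_neg_of_add_self_eq_T_min`**,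
`smul_sub_eq_T_min`, **`exists_primary_smul_sub_eq_T_min`**; §4 (`E/ℚ`, `Δ_E > 0`) **`kummerLetter_eq_T_min`**,
**`not_exists_primary_smul_sub_eq_T_of_ne_min`**, **`exists_not_mem_infKer_and_torsionToPrimaryH1Sub_mem_infKer`** (+ `ker κ`). References: J. H. Silverman, *AEC* III.2.3, Ex. III.3.7, X.1 (proof of Prop. 1.4: `x(½T) = e ± √((e − e′)(e − e″))`); J. S. Milne,
*ADT* I §3 Rem. 3.7 (`H¹(ℝ, E) ≅ E(ℝ)/E(ℝ)⁰`, the egg); R. Greenberg, LNM 1716 (1999) §4 p. 106, §5 Remark p. 174; crux workfile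
`RELAXED-COEFFICIENTS-att-p5.md` §8 (cell bsd-f1-sign2).
-/

set_option autoImplicit false
-- the Theorems namespace of this sub repeats the summit name by design (D-0017 nested layout)
set_option linter.dupNamespace false

noncomputable section

open scoped Classical

namespace Summit.BirchSwinnertonDyer.BirchSwinnertonDyer.Theorems.AlignedTransportAtTwoFineRoad.RealKummerLetter

open WeierstrassCurve NumberField Field Literature.NumberTheory.EllipticCurves
  Literature.NumberTheory.EllipticCurves.GreenbergSelmer Literature.NumberTheory.GaloisRepresentations
  Literature.NumberTheory.EllipticCurves.DokchitserDokchitser2012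
  Summit.BirchSwinnertonDyer.BirchSwinnertonDyer.Theorems.AlignedTransportAtTwoFineRoad
  Summit.BirchSwinnertonDyer.BirchSwinnertonDyer.Theorems.AlignedTransportAtTwoFineRoad.RealKummerWitnessPrelim
  Summit.BirchSwinnertonDyer.BirchSwinnertonDyer.Theorems.AlignedTransportAtTwoFineRoad.RealKummerValues
  Summit.BirchSwinnertonDyer.BirchSwinnertonDyer.Theorems.AlignedTransportAtTwoFineRoad.RealKummerIndex
  Summit.BirchSwinnertonDyer.BirchSwinnertonDyer.Theorems.AlignedTransportAtTwoFineRoad.RealKummerLine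

/-! ## §1 Two real-number facts -/

/-- If `s² = ab` with `0 < a`, `0 < b`, `a ≠ b`, then `s(s − a)(s − b) < 0` (`= ab(2s − a − b)` and `4s² = 4ab < (a + b)²`). [folklore] -/
theorem mul_mul_lt_zero_of_mul_self_eq (a b s : ℝ) (ha : 0 < a) (hb : 0 < b) (hab : a ≠ b) (hs : s * s = a * b) :
    s * (s - a) * (s - b) < 0 := by
  have hid : s * (s - a) * (s - b) = a * b * (2 * s - (a + b)) := by
    have : s * s * s = a * b * s := by rw [hs]
    nlinarith [this]
  have hlt : 2 * s < a + b := by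
    have hsq : (2 * s) * (2 * s) < (a + b) * (a + b) := by
      have hne : (a - b) * (a - b) > 0 := mul_self_pos.2 (sub_ne_zero.2 hab)
      nlinarith
    nlinarith [mul_pos ha hb]
  rw [hid]
  exact mul_neg_of_pos_of_neg (mul_pos ha hb) (by linarith)

/-- A complex number whose square is a positive real is real. [folklore] -/
theorem im_eq_zero_of_mul_self_eq_ofReal {z : ℂ} {r : ℝ} (hr : 0 < r) (hz : z * z = (r : ℂ)) : z.im = 0 := by
  have hre := congrArg Complex.re hz
  have him := congrArg Complex.im hz
  simp only [Complex.mul_re, Complex.ofReal_re, Complex.mul_im, Complex.ofReal_im] at hre him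
  have h2 : 2 * (z.re * z.im) = 0 := by linarith
  rcases mul_eq_zero.mp ((mul_eq_zero.mp h2).resolve_left two_ne_zero) with h0 | h0
  · exfalso
    rw [h0] at hre
    nlinarith [mul_self_nonneg z.im]
  · exact h0

/-! ## §2 `(2y + a₁x + a₃)² = 4(x − e₀)(x − e₁)(x − e₂)` on the curve -/

section Curve

variable {K : Type} [Field K] (W : WeierstrassCurve K) [W.IsElliptic] (h2 : (2 : K) ≠ 0)

/-- On the base-changed curve, `(2y + a₁x + a₃)² = 4x³ + b₂x² + 2b₄x + b₆ = 4(x − e₀)(x − e₁)(x − e₂)` (`eᵢ` the `2`-division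
abscissae; Vieta, tree `vieta_twoTorsion`). [cite: SilvermanAEC2009, III.§1 and Ex. III.3.7 (d)] -/
theorem psi_sq_eq_four_mul_prod {x y : AlgebraicClosure K} (hxy : (W.baseChange (AlgebraicClosure K)).toAffine.Equation x y) :
    (2 * y + (W.baseChange (AlgebraicClosure K)).a₁ * x + (W.baseChange (AlgebraicClosure K)).a₃) ^ 2 =
      4 * ((x - xT W h2 0) * (x - xT W h2 1) * (x - xT W h2 2)) := by
  set W' := W.baseChange (AlgebraicClosure K) with hW'
  obtain ⟨hb2, hb4, hb6⟩ := vieta_twoTorsion W h2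
  rw [← hW'] at hb2 hb4 hb6
  have hcurve : y ^ 2 + W'.a₁ * x * y + W'.a₃ * y = x ^ 3 + W'.a₂ * x ^ 2 + W'.a₄ * x + W'.a₆ :=
    (Affine.equation_iff _ _).mp hxy
  have hpsi : (2 * y + W'.a₁ * x + W'.a₃) ^ 2 = 4 * x ^ 3 + W'.b₂ * x ^ 2 + 2 * W'.b₄ * x + W'.b₆ := by
    simp only [WeierstrassCurve.b₂, WeierstrassCurve.b₄, WeierstrassCurve.b₆]
    linear_combination 4 * hcurve
  rw [hpsi, hb2, hb4, hb6]
  ring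

end Curve

/-! ## §3 Halves of `T_{min}` are anti-invariant under complex conjugation -/

section Halves

variable {K : Type} [Field K] [CharZero K] (W : WeierstrassCurve K) [W.IsElliptic]

omit [CharZero K] [W.IsElliptic] in
/-- The Galois action on an affine point is coordinatewise (unfolding). [cite: SilvermanAEC2009, VIII.§1] -/
theorem smul_some_eq (σ : absoluteGaloisGroup K) {x y : AlgebraicClosure K}
    (h : (W.baseChange (AlgebraicClosure K)).toAffine.Nonsingular x y) :
    ∃ h' : (W.baseChange (AlgebraicClosure K)).toAffine.Nonsingular (σ • x) (σ • y),
      σ • (@id (geomPoints W) (Affine.Point.some x y h)) = @id (geomPoints W) (Affine.Point.some (σ • x) (σ • y) h') :=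
  ⟨_, rfl⟩

omit [CharZero K] [W.IsElliptic] in
/-- If `σ` fixes an affine point, it fixes its ordinate. [cite: SilvermanAEC2009, VIII.§1] -/
theorem smul_y_eq_of_smul_some_eq (σ : absoluteGaloisGroup K) {x y : AlgebraicClosure K}
    (h : (W.baseChange (AlgebraicClosure K)).toAffine.Nonsingular x y)
    (hfix : σ • (@id (geomPoints W) (Affine.Point.some x y h)) = @id (geomPoints W) (Affine.Point.some x y h)) : σ • y = y := by
  obtain ⟨h', hsmul⟩ := smul_some_eq W σ h
  rw [hsmul] at hfix
  exact ((Affine.Point.some.injEq _ _ _ _ _ _).mp hfix).2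

omit [CharZero K] [W.IsElliptic] in
/-- A complex conjugation `τ ∈ Γ_K` (under `ι`) makes `ι` real on `K`: `ι(k) ∈ ℝ`. [cite: SerreAbelianLadic1968, Ch. I §2.2] -/
theorem im_algebraMap_eq_zero {τ : absoluteGaloisGroup K} (ι : AlgebraicClosure K →+* ℂ)
    (hι : ∀ x : AlgebraicClosure K, ι (τ • x) = starRingEnd ℂ (ι x)) (k : K) :
    (ι (algebraMap K (AlgebraicClosure K) k)).im = 0 := by
  have h1 : τ • algebraMap K (AlgebraicClosure K) k = algebraMap K (AlgebraicClosure K) k := by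
    rw [absoluteGaloisGroup.smul_def]
    exact (absoluteGaloisGroup.toAlgEquiv K τ).commutes k
  have h3 : starRingEnd ℂ (ι (algebraMap K (AlgebraicClosure K) k)) = ι (algebraMap K (AlgebraicClosure K) k) := by
    rw [← hι, h1]
  exact Complex.conj_eq_iff_im.mp h3

omit [CharZero K] in
/-- `u′(e_i) = 4 αᵢ` with `αᵢ = (eᵢ − eᵢ₊₁)(eᵢ − eᵢ₊₂)` (tree `uT_eq`, reindexed). [cite: SilvermanAEC2009, Ex. III.3.7 (d)] -/
theorem uq_xT_eq (hK2 : (2 : K) ≠ 0) (i : Fin 3) :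
    uq W (xT W hK2 i) = 4 * ((xT W hK2 i - xT W hK2 (i + 1)) * (xT W hK2 i - xT W hK2 (i + 2))) := by
  obtain ⟨h0, h1, h2'⟩ := uT_eq W hK2
  have e01 : ((0 : Fin 3) + 1) = 1 := by decide
  have e02 : ((0 : Fin 3) + 2) = 2 := by decide
  have e11 : ((1 : Fin 3) + 1) = 2 := by decide
  have e12 : ((1 : Fin 3) + 2) = 0 := by decide
  have e21 : ((2 : Fin 3) + 1) = 0 := by decide
  have e22 : ((2 : Fin 3) + 2) = 1 := by decide
  change uT W hK2 i = _
  fin_cases i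
  · simp only [Fin.zero_eta, Fin.isValue, e01, e02]
    exact h0
  · simp only [Fin.mk_one, Fin.isValue, e11, e12]
    rw [h1]; ring
  · simp only [Fin.reduceFinMk, Fin.isValue, e21, e22]
    exact h2'

omit [CharZero K] in
/-- The product `(x − e₀)(x − e₁)(x − e₂)` reindexed from any letter. [folklore] -/
theorem prod_sub_xT_eq (hK2 : (2 : K) ≠ 0) (x : AlgebraicClosure K) (i : Fin 3) :
    (x - xT W hK2 0) * (x - xT W hK2 1) * (x - xT W hK2 2) =
      (x - xT W hK2 i) * (x - xT W hK2 (i + 1)) * (x - xT W hK2 (i + 2)) := by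
  have e01 : ((0 : Fin 3) + 1) = 1 := by decide
  have e02 : ((0 : Fin 3) + 2) = 2 := by decide
  have e11 : ((1 : Fin 3) + 1) = 2 := by decide
  have e12 : ((1 : Fin 3) + 2) = 0 := by decide
  have e21 : ((2 : Fin 3) + 1) = 0 := by decide
  have e22 : ((2 : Fin 3) + 2) = 1 := by decide
  fin_cases i
  · simp only [Fin.zero_eta, Fin.isValue, e01, e02]
  · simp only [Fin.mk_one, Fin.isValue, e11, e12]; ring
  · simp only [Fin.reduceFinMk, Fin.isValue, e21, e22]; ring

/-- **Halves of `T_{min}` are anti-invariant under complex conjugation.** Let `τ ∈ ker ρ̄_{E,2}` act as complex conjugation under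
`ι : K̄ → ℂ` (so the abscissae `ι eᵢ` are real), let `e_{i₁}` have the LEAST real abscissa, and let `Q ∈ E(K̄)` with `2Q = T_{i₁}`. Then
`τ Q = −Q`. Indeed the halving identity (tree `four_mul_sq_xco_sub_eq`) gives `(x(Q) − e_{i₁})² = α_{i₁} = (e_{i₁} − e_j)(e_{i₁} − e_k) > 0`,
so `x(Q)` is REAL and `τ Q = ± Q`; and `τ Q = Q` would make `y(Q)` real too, whereas `(2y + a₁x + a₃)² = 4(x − e₀)(x − e₁)(x − e₂) < 0` at
`x = x(Q) = e_{i₁} ± √α_{i₁}` (both abscissae lie where the cubic is negative: `s(s − a)(s − b) = ab(2s − a − b) < 0` for `s² = ab`).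
[cite: SilvermanAEC2009, X.1 (proof of Prop. 1.4: x(½T) = e ± √((e−e′)(e−e″)))] [cite: MilneADT2006, Ch. I §3 (Rem. 3.7)] -/
theorem smul_eq_neg_of_add_self_eq_T_min (hK2 : (2 : K) ≠ 0) {τ : absoluteGaloisGroup K} (hτ : τ ∈ (W.galoisRepTorsion 2).ker)
    (ι : AlgebraicClosure K →+* ℂ) (hι : ∀ x : AlgebraicClosure K, ι (τ • x) = starRingEnd ℂ (ι x))
    {i₁ : Fin 3} (hmin : ∀ i, (ι (xT W hK2 i₁)).re ≤ (ι (xT W hK2 i)).re)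
    {Q : geomPoints W} (hQ : Q + Q = (T W hK2 i₁ : geomPoints W)) : τ • Q = -Q := by
  set W' := W.baseChange (AlgebraicClosure K) with hW'
  set e : Fin 3 → AlgebraicClosure K := xT W hK2 with he
  -- the abscissae are real under `ι`
  have hperm : permGal W hK2 τ = 1 := permGal_eq_one_of_mem_ker W hK2 hτ
  have hreal : ∀ i, (ι (e i)).im = 0 := by
    intro i
    have h1 : τ • e i = e i := by rw [he, smul_xT, hperm, Equiv.Perm.one_apply]
    have h3 : starRingEnd ℂ (ι (e i)) = ι (e i) := by rw [← hι, h1]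
    exact Complex.conj_eq_iff_im.mp h3
  set r : Fin 3 → ℝ := fun i ↦ (ι (e i)).re with hr
  have hιe : ∀ i, ι (e i) = ((r i : ℝ) : ℂ) := fun i ↦ Complex.ext (by simp [hr]) (by simp [hreal i])
  have hrinj : Function.Injective r := by
    intro i j hij
    apply xT_injective W hK2
    apply ι.injective
    rw [← he, hιe, hιe, hij]
  have hs1 : ∀ j : Fin 3, j + 1 ≠ j := by decide
  have hs2 : ∀ j : Fin 3, j + 2 ≠ j := by decide
  have hs12 : ∀ j : Fin 3, j + 1 ≠ j + 2 := by decide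
  -- `a = r(i₁+1) − r i₁ > 0`, `b = r(i₁+2) − r i₁ > 0`, `a ≠ b`
  have ha : 0 < r (i₁ + 1) - r i₁ := sub_pos.2 (lt_of_le_of_ne (hmin _) (fun h ↦ hs1 i₁ (hrinj h.symm)))
  have hb : 0 < r (i₁ + 2) - r i₁ := sub_pos.2 (lt_of_le_of_ne (hmin _) (fun h ↦ hs2 i₁ (hrinj h.symm)))
  have hab : r (i₁ + 1) - r i₁ ≠ r (i₁ + 2) - r i₁ := fun h ↦ hs12 i₁ (hrinj (by linarith))
  -- the halving identity: `(x(Q) − e_{i₁})² = α_{i₁}`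
  have hT0 := coe_T_ne_zero W hK2 i₁
  have hT2 := coe_add_self_eq_zero W (T W hK2 i₁)
  have hQ0 : Q ≠ 0 := by
    rintro rfl
    rw [add_zero] at hQ
    exact hT0 hQ.symm
  have h2' : (2 : AlgebraicClosure K) ≠ 0 := two_ne_zero
  have hhalf : (xco W Q - e i₁) * (xco W Q - e i₁) = (e i₁ - e (i₁ + 1)) * (e i₁ - e (i₁ + 2)) := by
    have h := four_mul_sq_xco_sub_eq W hT0 hT2 hQ
    have hx : xco W (T W hK2 i₁ : geomPoints W) = e i₁ := rfl
    rw [hx, uq_xT_eq W hK2 i₁] at h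
    have h4 : (4 : AlgebraicClosure K) ≠ 0 := by norm_num
    have := mul_left_cancel₀ h4 h
    rw [← pow_two]; exact this
  -- apply `ι`: `(ι x(Q) − r i₁)² = (r(i₁+1) − r i₁)(r(i₁+2) − r i₁) > 0`, so `ι x(Q)` is real
  set z : ℂ := ι (xco W Q) - (r i₁ : ℂ) with hz
  have hzz : z * z = (((r (i₁ + 1) - r i₁) * (r (i₁ + 2) - r i₁) : ℝ) : ℂ) := by
    have h := congrArg ι hhalf
    rw [map_mul, map_sub, map_mul, map_sub, map_sub, hιe, hιe, hιe] at h
    rw [hz, h]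
    push_cast
    ring
  have hzim : z.im = 0 := im_eq_zero_of_mul_self_eq_ofReal (mul_pos ha hb) hzz
  have hxim : (ι (xco W Q)).im = 0 := by
    have : (ι (xco W Q)).im = z.im + ((r i₁ : ℝ) : ℂ).im := by rw [hz]; simp
    rw [this, hzim, Complex.ofReal_im, add_zero]
  have hxfix : τ • xco W Q = xco W Q := by
    apply ι.injective
    rw [hι]
    exact Complex.conj_eq_iff_im.mpr hxim
  -- `τ Q = ± Q`
  have hτQ0 : τ • Q ≠ 0 := by
    intro h
    apply hQ0
    have := congrArg (fun P ↦ τ⁻¹ • P) h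
    simpa using this
  rcases eq_or_eq_neg_of_xco_eq W hτQ0 hQ0 (by rw [xco_smul, hxfix]) with hfix | hneg
  · -- `τ Q = Q` is impossible: `y(Q)` would be real and `(2y + a₁x + a₃)² = 4(x−e₀)(x−e₁)(x−e₂) < 0`
    exfalso
    change W'.toAffine.Point at Q
    rcases Q with _ | ⟨x, y, hxy⟩
    · exact hQ0 rfl
    have hyfix : τ • y = y := smul_y_eq_of_smul_some_eq W τ hxy hfix
    have hxQ : xco W (Affine.Point.some x y hxy : geomPoints W) = x := rfl
    rw [hxQ] at hxim hhalf hz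
    have hyim : (ι y).im = 0 := by
      have h3 : starRingEnd ℂ (ι y) = ι y := by rw [← hι, hyfix]
      exact Complex.conj_eq_iff_im.mp h3
    -- `ψ = 2y + a₁x + a₃` is real
    set ψ : AlgebraicClosure K := 2 * y + W'.a₁ * x + W'.a₃ with hψ
    have ha₁ : (ι W'.a₁).im = 0 := by
      rw [hW', baseChange, map_a₁]; exact im_algebraMap_eq_zero ι hι W.a₁
    have ha₃ : (ι W'.a₃).im = 0 := by
      rw [hW', baseChange, map_a₃]; exact im_algebraMap_eq_zero ι hι W.a₃
    have hψim : (ι ψ).im = 0 := by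
      rw [hψ, map_add, map_add, map_mul, map_mul, map_ofNat]
      simp only [Complex.add_im, Complex.mul_im, hyim, hxim, ha₁, ha₃, mul_zero, zero_mul, add_zero,
        Complex.re_ofNat, Complex.im_ofNat]
    -- `ψ² = 4 ∏ (x − eᵢ)` and its `ι`-image is `4 s (s−a)(s−b) < 0`
    have hsq := psi_sq_eq_four_mul_prod W hK2 hxy.1
    rw [prod_sub_xT_eq W hK2 x i₁] at hsq
    set s : ℝ := (ι x).re - r i₁ with hsdef
    have hιx : ι x = (((ι x).re : ℝ) : ℂ) := Complex.ext (by simp) (by simp [hxim])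
    have hss : s * s = (r (i₁ + 1) - r i₁) * (r (i₁ + 2) - r i₁) := by
      have hzs : z = (s : ℂ) := by rw [hz, hιx, hsdef]; push_cast; ring
      have h := hzz
      rw [hzs] at h
      exact_mod_cast h
    have hneg := mul_mul_lt_zero_of_mul_self_eq _ _ s ha hb hab hss
    have hιψ : ι ψ * ι ψ = ((4 * (s * (s - (r (i₁ + 1) - r i₁)) * (s - (r (i₁ + 2) - r i₁))) : ℝ) : ℂ) := by
      rw [← map_mul, ← pow_two, hψ, hsq, map_mul, map_ofNat, map_mul, map_mul, map_sub, map_sub, map_sub, hιe, hιe, hιe, hιx,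
        hsdef]
      push_cast
      ring
    have hre := congrArg Complex.re hιψ
    rw [Complex.mul_re, hψim, mul_zero, sub_zero, Complex.ofReal_re] at hre
    nlinarith [mul_self_nonneg (ι ψ).re]
  · exact hneg

/-- Hence `τ Q − Q = T_{min}` for every half `Q` of `T_{min}` (`−T = T`). [cite: SilvermanAEC2009, X.1 (proof of Prop. 1.4)] -/
theorem smul_sub_eq_T_min (hK2 : (2 : K) ≠ 0) {τ : absoluteGaloisGroup K} (hτ : τ ∈ (W.galoisRepTorsion 2).ker)
    (ι : AlgebraicClosure K →+* ℂ) (hι : ∀ x : AlgebraicClosure K, ι (τ • x) = starRingEnd ℂ (ι x))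
    {i₁ : Fin 3} (hmin : ∀ i, (ι (xT W hK2 i₁)).re ≤ (ι (xT W hK2 i)).re)
    {Q : geomPoints W} (hQ : Q + Q = (T W hK2 i₁ : geomPoints W)) : τ • Q - Q = (T W hK2 i₁ : geomPoints W) := by
  rw [smul_eq_neg_of_add_self_eq_T_min W hK2 hτ ι hι hmin hQ]
  have hT2 := coe_add_self_eq_zero W (T W hK2 i₁)
  have hnegT : -(T W hK2 i₁ : geomPoints W) = (T W hK2 i₁ : geomPoints W) := by
    rw [neg_eq_iff_add_eq_zero, hT2]
  rw [show -Q - Q = -(Q + Q) by abel, hQ, hnegT]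

/-- **`T_{min}` lies on the line `(τ − 1)·E[2^∞]`**: there is `a ∈ E[2^∞]` (a half of `T_{min}`, `E[2^∞]` being `2`-divisible) with
`τ a − a = T_{min}`. Contrast att-p5 g8 `RealKummerTranslation.not_exists_smul_eq_add_T`: the middle letter is not `τ P − P` for any
`P ∈ E(K̄)`. [cite: MilneADT2006, Ch. I §3 (Rem. 3.7)] [cite: SilvermanAEC2009, X.1 (proof of Prop. 1.4)] -/
theorem exists_primary_smul_sub_eq_T_min (hK2 : (2 : K) ≠ 0) {τ : absoluteGaloisGroup K} (hτ : τ ∈ (W.galoisRepTorsion 2).ker)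
    (ι : AlgebraicClosure K →+* ℂ) (hι : ∀ x : AlgebraicClosure K, ι (τ • x) = starRingEnd ℂ (ι x))
    {i₁ : Fin 3} (hmin : ∀ i, (ι (xT W hK2 i₁)).re ≤ (ι (xT W hK2 i)).re) :
    ∃ a : ↥(W.geomPrimaryTorsion 2), τ • a - a =
      AddSubgroup.inclusion (geomTorsion_le_geomPrimaryTorsion W 2) (T W hK2 i₁) := by
  obtain ⟨a, ha⟩ := W.exists_nsmul_eq_geomPrimaryTorsion 2 W.zsmul_geomPoints_surjective_holds
    (AddSubgroup.inclusion (geomTorsion_le_geomPrimaryTorsion W 2) (T W hK2 i₁))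
  refine ⟨a, Subtype.ext ?_⟩
  have hQ : (a : geomPoints W) + a = (T W hK2 i₁ : geomPoints W) := by
    have := congrArg Subtype.val ha
    simpa [two_nsmul] using this
  have h := smul_sub_eq_T_min W hK2 hτ ι hι hmin hQ
  simpa [primaryComponent.coe_smul] using h

end Halves

/-! ## §4 `E/ℚ`, `Δ_E > 0`: the Kummer letter `T_w` IS `T_{min}`; the `T_{min}`-class survives in `E[2^∞]`, the other two letters do not -/

section Rat

variable (W : WeierstrassCurve ℚ) [W.IsElliptic] (H : Subgroup (absoluteGaloisGroup ℚ)) (w : InfinitePlace ℚ)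

/-- **The Kummer letter is the letter with the least real abscissa: `T_w = T_{min}`.** For `Δ_E > 0`, a non-trivial `g ∈ H ⊓ D_w`
(complex conjugation under `ι`) and the Kummer letter `T_w` of `RealKummerLine.exists_kummerLetter` (the unique non-zero `2`-torsion point
on `(g − 1)·E[2^∞]`): `T_w = T_{i₁}` where `ι e_{i₁}` is the least of the three real abscissae — `T_{i₁}` lies on that line by
`exists_primary_smul_sub_eq_T_min`. (The arch package's `ℚ_w`-coordinate statement «`T_w` ↦ the point above the least root `e₃`», now in
`Γ_ℚ`/`ι`-coordinates, compatible with the evaluation classes of `RealKummerValues`.) [cite: GreenbergLNM1716, §5 Remark p. 174]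
[cite: SilvermanAEC2009, X.1 (Prop. 1.4)] -/
theorem kummerLetter_eq_T_min {g : ↥(H ⊓ decompInf w)} (hgker : (g : absoluteGaloisGroup ℚ) ∈ (W.galoisRepTorsion 2).ker)
    (ι : AlgebraicClosure ℚ →+* ℂ) (hι : ∀ x : AlgebraicClosure ℚ, ι ((g : absoluteGaloisGroup ℚ) • x) = starRingEnd ℂ (ι x))
    {i₁ : Fin 3} (hmin : ∀ i, (ι (xT W two_ne_zero i₁)).re ≤ (ι (xT W two_ne_zero i)).re) {Tw : ↥(W.geomTorsion 2)}
    (hline : ∀ t : ↥(W.geomTorsion 2),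
      (∃ a : ↥(W.geomPrimaryTorsion 2), (g : absoluteGaloisGroup ℚ) • a - a =
          AddSubgroup.inclusion (geomTorsion_le_geomPrimaryTorsion W 2) t) ↔ (t = 0 ∨ t = Tw)) :
    Tw = T W two_ne_zero i₁ := by
  have h := (hline (T W two_ne_zero i₁)).mp (exists_primary_smul_sub_eq_T_min W two_ne_zero hgker ι hι hmin)
  rcases h with h0 | h1
  · exact absurd h0 (ThetaPartnerXRoute.T_ne_zero' two_ne_zero W i₁)
  · exact h1.symm

/-- **Only `T_{min}` lies on the line `(c_w − 1)·E[2^∞]`**: for every letter `T_i` with `i ≠ i₁` (the middle one — att-p5 g8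
`RealKummerTranslation` — AND the largest one) there is no `a ∈ E[2^∞]` with `c_w a − a = T_i`. [cite: MilneADT2006, Ch. I §3 (Rem. 3.7)]
[cite: GreenbergLNM1716, §4 p. 106] -/
theorem not_exists_primary_smul_sub_eq_T_of_ne_min (hΔ : 0 < W.Δ) {g : ↥(H ⊓ decompInf w)} (hg : g ≠ 1)
    (hgker : (g : absoluteGaloisGroup ℚ) ∈ (W.galoisRepTorsion 2).ker)
    (ι : AlgebraicClosure ℚ →+* ℂ) (hι : ∀ x : AlgebraicClosure ℚ, ι ((g : absoluteGaloisGroup ℚ) • x) = starRingEnd ℂ (ι x))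
    {i₁ : Fin 3} (hmin : ∀ i, (ι (xT W two_ne_zero i₁)).re ≤ (ι (xT W two_ne_zero i)).re) {i : Fin 3} (hi : i ≠ i₁) :
    ¬ ∃ a : ↥(W.geomPrimaryTorsion 2), (g : absoluteGaloisGroup ℚ) • a - a =
        AddSubgroup.inclusion (geomTorsion_le_geomPrimaryTorsion W 2) (T W two_ne_zero i) := by
  obtain ⟨Tw, -, hline⟩ := RealKummerLine.exists_kummerLetter W H w hΔ hg
  have hTw := kummerLetter_eq_T_min W H w hgker ι hι hmin hline
  intro h
  rcases (hline _).mp h with h0 | h1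
  · exact ThetaPartnerXRoute.T_ne_zero' two_ne_zero W i h0
  · exact hi (T_injective W two_ne_zero (h1.trans hTw))

/-- **The `T_{min}`-class survives in `E[2^∞]`, witnessing `relIndex = 2` explicitly.** For `Δ_E > 0` and `H ⊇ D_w` there is a class
`y ∈ H¹(H, E[2])` OUTSIDE the strict `E[2]`-condition (`y ∉ infKer H E[2] w`: its value at `c_w` is `T_{min} ≠ O`) whose push-forward
`ι_* y ∈ H¹(H, E[2^∞])` SATISFIES the archimedean condition (`∈ infKer H E[2^∞] w`: `T_{min} = T_w` is on the Kummer line) — the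
equivariant Kummer class of the units `eᵢ − q`, `q` rational just above the least real root (`RealKummerValues`). The classes with values
`T_{mid}` (g8, `αᵢ`) and `T_{max}` (`eᵢ − q′`) push forward OUTSIDE it. [cite: GreenbergLNM1716, §4 p. 106] [cite: SilvermanAEC2009, X.1 (Prop. 1.4)] -/
theorem exists_not_mem_infKer_and_torsionToPrimaryH1Sub_mem_infKer (hΔ : 0 < W.Δ) (hH : decompInf w ≤ H) :
    ∃ y : subgroupH1 H ↥(W.geomTorsion 2), y ∉ infKer H ↥(W.geomTorsion 2) w ∧
      W.torsionToPrimaryH1Sub 2 H y ∈ infKer H ↥(W.geomPrimaryTorsion 2) w := by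
  have htriv := RealKummerIndex.smul_eq_self_inf_decompInf W (RealKummerWitness.forall_smul_eq_of_Δ_pos W hΔ w) H
  obtain ⟨g, hg⟩ := RealKummerIndex.exists_ne_one_inf_decompInf (IsTotallyReal.isReal w) H hH
  obtain ⟨ι, hι⟩ := RealKummerIndex.exists_embedding_of_ne_one (IsTotallyReal.isReal w) H hg
  have hgker : (g : absoluteGaloisGroup ℚ) ∈ (W.galoisRepTorsion 2).ker :=
    PerfectDescent.mem_ker_galoisRepTorsion_two_of_forall_smul_eq W (fun v ↦ htriv g v)
  obtain ⟨i₁, i₃, -, hmin, -, ⟨y₁, hy₁⟩, -⟩ :=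
    RealKummerValues.exists_classes_apply_eq_T_min_max W two_ne_zero H (τ := (g : absoluteGaloisGroup ℚ)) ⟨g.2.1, hgker⟩ ι hι
  obtain ⟨Tw, -, hline, hiff⟩ := RealKummerLine.exists_kummerLetter_torsionToPrimaryH1Sub_mem_infKer_iff W H w hΔ htriv hg
  have hTw := kummerLetter_eq_T_min W H w hgker ι hι hmin hline
  obtain ⟨ζ, rfl⟩ := oneCocycleClass_surjective _ y₁
  have hval : evalH1 htriv g (resOfLe (↥(W.geomTorsion 2)) (inf_le_left : H ⊓ decompInf w ≤ H) (oneCocycleClass _ ζ)) =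
      T W two_ne_zero i₁ := by
    rw [RealKummerIndex.evalH1_resOfLe_oneCocycleClass, hy₁ ζ rfl]
  refine ⟨oneCocycleClass _ ζ, ?_, ?_⟩
  · rw [RealKummerIndex.mem_infKer_iff_evalH1_eq_zero W H htriv hg, hval]
    exact ThetaPartnerXRoute.T_ne_zero' two_ne_zero W i₁
  · rw [hiff, hval, hTw]
    exact Or.inr rfl

variable {p : ℕ} [Fact p.Prime] (κ : ZpExtension ℚ p)

/-- Over `ℚ_∞` (cyclotomic `ℤ_p`-extension, any `p`; `Δ_E > 0`): an explicit class of `H¹(ℚ_∞, E[2])` outside the strict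
`E[2]`-archimedean condition whose push-forward to `H¹(ℚ_∞, E[2^∞])` is locally trivial at the real place.
[cite: GreenbergLNM1716, §4 Lemma 4.6 and p. 106] -/
theorem exists_not_mem_infKer_and_torsionToPrimaryH1Sub_mem_infKer_kerSubgroup (hκ : κ.IsCyclotomic) (hΔ : 0 < W.Δ) :
    ∃ y : subgroupH1 κ.kerSubgroup ↥(W.geomTorsion 2), y ∉ infKer κ.kerSubgroup ↥(W.geomTorsion 2) w ∧
      W.torsionToPrimaryH1Sub 2 κ.kerSubgroup y ∈ infKer κ.kerSubgroup ↥(W.geomPrimaryTorsion 2) w :=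
  exists_not_mem_infKer_and_torsionToPrimaryH1Sub_mem_infKer W κ.kerSubgroup w hΔ
    (RealKummerWitness.decompInf_le_kerSubgroup κ hκ (IsTotallyReal.isReal w))

end Rat

end Summit.BirchSwinnertonDyer.BirchSwinnertonDyer.Theorems.AlignedTransportAtTwoFineRoad.RealKummerLetter

end
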